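import Mathlib
import Summits.ValiantsHypothesis.ValiantsHypothesis.Theorems.NewtonUnitEquationsDissociatedFixedKExposedWord

/-!
# Crux `TwoProducts` (stmt-ValiantsHypothesis-5906), line `FrameRungTwo`: the CARRY LEMMA for `stub_crossCancelCount`

Registered forward line `Cruxes/TwoProducts/Lines/FrameRungTwo.lean` (rung `FrameRungTwo`: `k` products of `m` bivariate
polynomials drawn from TWO dissociated frames `A 0, A 1`).  Its stubs `stub_classHull` (p579112) and `stub_faceCount`
(p580655) are landed; the OPEN core is `stub_crossCancelCount` (the CROSS-CANCELLING vertices are few).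

This helper isolates the first structural fact any proof of the core must use, in the two-product case (one product per
frame, `F = Π_j f_j + Π_j g_j`, `supp f_j ⊆ A_j`, `supp g_j ⊆ B_j`, both frames dissociated).  At a cross-cancelling
vertex `e = Σ_j a_j` (an `A`-word) the floor's device (`DissociatedFixedK.stub_thicknessFit`) puts a two-letter cube
`Π_{j∈J} {a_j, b_j}` above `e`, all of whose points other than `e` are cancelled AGAINST THE OTHER FRAME `B`.  The lemma:
**a cancelled 2-face of that cube through `a` cannot be CARRY-FREE in `B`.**  Precisely (`coeff_eq_zero_of_carryFree_face`):
if `a, a₁, a₂, a₁₂` is a coordinate rectangle of `A`-words (`a` is the merge of `a₁, a₂` over `a₁₂`), the three corners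
`a₁, a₂, a₁₂` are cancelled (`coeff (Σ a₁) F = 0`, …) against `B`-words `β₁, β₂, β₁₂` with the same exponent sums, the
product `Π_j f_j` is alive at `a₁₂`, and the `B`-representation is carry-free (`β₁ j = β₁₂ j ∨ β₂ j = β₁₂ j` for every
`B`-coordinate `j`, i.e. the coordinate sets on which `β₁₂` differs from `β₁` and from `β₂` are disjoint), then the merge
word `β₀` of `β₁, β₂` over `β₁₂` is a `B`-word with exponent sum `Σ a`, and the coefficient of `X^{Σ a}` in `F` VANISHES —
so `e` is not in the support, let alone a vertex.  Contrapositive: at a cross-cancelling vertex with `|J| ≥ 2`, every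
2-face through the vertex word CARRIES in the other frame (some `B`-coordinate moves under both edges of the face).  Hence
the line card's "carry-free ⇒ `thickness_of_annihilator` verbatim" covers only `|J| ≤ 1` at `k = 2`; the carrying case is
the whole content of the stub (two dissociated systems representing a common `l`-upper set; de Bruijn's complementing
systems are its one-dimensional shadow).

Contents: §1 the merge word of a carry-free corner triple (pure combinatorics, any alphabet) and its additive /
multiplicative valuations; §2 the coefficient form over a domain; §3 the polynomial form on two dissociated frames.
Only Mathlib and the floor's coefficient formula (`DissociatedFixedK.coeff_sum_prod_of_dissociated`) are used.
Nothing here bears on the crux `TwoProducts` itself or on `VP ≠ VNP`. [folklore; setting KPTT arXiv:1308.2286 §2]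
-/

set_option linter.dupNamespace false

namespace Summit.ValiantsHypothesis.ValiantsHypothesis.Theorems.NewtonFramesTwoProducts.FrameRungTwoCarry

open MvPolynomial
open scoped BigOperators

/-! ## §1  The merge word of a carry-free corner triple -/

/-- **Merge word.**  If three words `β₁, β₂, β₁₂` of a frame `B` are CARRY-FREE — at every coordinate `β₁₂` agrees with
`β₁` or with `β₂` — then the coordinatewise merge `β₀` ("`β₂` where `β₁` agrees with `β₁₂`, else `β₁`") is again a word
of `B`, and at every coordinate the quadruple `(β₀, β₁, β₂, β₁₂)` is a rectangle: `β₀ = β₁, β₂ = β₁₂` or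
`β₀ = β₂, β₁ = β₁₂`. [folklore] -/
theorem exists_merge_word {m : ℕ} {E : Type*} [DecidableEq E] (B : Fin m → Finset E) (β₁ β₂ β₁₂ : Fin m → E)
    (h₁ : ∀ j, β₁ j ∈ B j) (h₂ : ∀ j, β₂ j ∈ B j) (hcf : ∀ j, β₁ j = β₁₂ j ∨ β₂ j = β₁₂ j) :
    ∃ β₀ : Fin m → E, (∀ j, β₀ j ∈ B j) ∧
      ∀ j, (β₀ j = β₁ j ∧ β₂ j = β₁₂ j) ∨ (β₀ j = β₂ j ∧ β₁ j = β₁₂ j) := by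
  refine ⟨fun j => if β₁ j = β₁₂ j then β₂ j else β₁ j, fun j => ?_, fun j => ?_⟩
  · by_cases h : β₁ j = β₁₂ j
    · simp only [h, if_true]; exact h₂ j
    · simp only [h, if_false]; exact h₁ j
  · by_cases h : β₁ j = β₁₂ j
    · exact Or.inr ⟨by simp only [h, if_true], h⟩
    · rcases hcf j with h' | h'
      · exact absurd h' h
      · exact Or.inl ⟨by simp only [h, if_false], h'⟩

/-- Additive valuation of a rectangle of words: `Y β₀ + Y β₁₂ = Y β₁ + Y β₂` for every coordinatewise-additive
`Y β = Σ_j y_j (β_j)` (e.g. the exponent-sum map, or additive coefficient labels). [folklore] -/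
theorem sum_rect_eq {m : ℕ} {E M : Type*} [AddCommMonoid M] (y : Fin m → E → M) (β₀ β₁ β₂ β₁₂ : Fin m → E)
    (hrect : ∀ j, (β₀ j = β₁ j ∧ β₂ j = β₁₂ j) ∨ (β₀ j = β₂ j ∧ β₁ j = β₁₂ j)) :
    ∑ j, y j (β₀ j) + ∑ j, y j (β₁₂ j) = ∑ j, y j (β₁ j) + ∑ j, y j (β₂ j) := by
  rw [← Finset.sum_add_distrib, ← Finset.sum_add_distrib]
  refine Finset.sum_congr rfl fun j _ => ?_
  rcases hrect j with ⟨h0, h2⟩ | ⟨h0, h1⟩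
  · rw [h0, h2]
  · rw [h0, h1, add_comm]

/-- Multiplicative valuation of a rectangle of words: `D β₀ · D β₁₂ = D β₁ · D β₂` for every coordinatewise-multiplicative
`D β = Π_j d_j (β_j)` (e.g. the coefficient of a product of polynomials at a frame word). [folklore] -/
theorem prod_rect_eq {m : ℕ} {E R : Type*} [CommMonoid R] (d : Fin m → E → R) (β₀ β₁ β₂ β₁₂ : Fin m → E)
    (hrect : ∀ j, (β₀ j = β₁ j ∧ β₂ j = β₁₂ j) ∨ (β₀ j = β₂ j ∧ β₁ j = β₁₂ j)) :
    (∏ j, d j (β₀ j)) * ∏ j, d j (β₁₂ j) = (∏ j, d j (β₁ j)) * ∏ j, d j (β₂ j) := by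
  rw [← Finset.prod_mul_distrib, ← Finset.prod_mul_distrib]
  refine Finset.prod_congr rfl fun j _ => ?_
  rcases hrect j with ⟨h0, h2⟩ | ⟨h0, h1⟩
  · rw [h0, h2]
  · rw [h0, h1, mul_comm]

/-! ## §2  Coefficient form: a carry-free cancelled face cancels its fourth corner -/

/-- **Carry lemma, coefficient form** (two products, coefficient tensors `c` on frame `A` and `d` on frame `B` over a
domain).  Let `(a, a₁, a₂, a₁₂)` be a rectangle of `A`-words and `β₁, β₂, β₁₂` CARRY-FREE `B`-words such that the three
corners are cross-cancelled: `Π c(a₁) + Π d(β₁) = 0`, `Π c(a₂) + Π d(β₂) = 0`, `Π c(a₁₂) + Π d(β₁₂) = 0`, with the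
`A`-product alive at `a₁₂`.  Then the merge word `β₀` is a `B`-word, `(β₀, β₁, β₂, β₁₂)` is a rectangle (so
`Σ β₀ + Σ β₁₂ = Σ β₁ + Σ β₂` for any additive valuation, `sum_rect_eq`), and the fourth corner is cancelled too:
`Π c(a) + Π d(β₀) = 0`.  [Proof: `Π d(β₀)·Π d(β₁₂) = Π d(β₁)·Π d(β₂) = Π c(a₁)·Π c(a₂) = Π c(a)·Π c(a₁₂)
= −Π c(a)·Π d(β₁₂)`, cancel `Π d(β₁₂) ≠ 0`.] [folklore] -/
theorem exists_merge_cancel {m : ℕ} {E R : Type*} [DecidableEq E] [CommRing R] [IsDomain R]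
    (B : Fin m → Finset E) (c d : Fin m → E → R) (a a₁ a₂ a₁₂ : Fin m → E) (β₁ β₂ β₁₂ : Fin m → E)
    (hArect : ∀ j, (a j = a₁ j ∧ a₂ j = a₁₂ j) ∨ (a j = a₂ j ∧ a₁ j = a₁₂ j))
    (hβ₁ : ∀ j, β₁ j ∈ B j) (hβ₂ : ∀ j, β₂ j ∈ B j)
    (hcf : ∀ j, β₁ j = β₁₂ j ∨ β₂ j = β₁₂ j)
    (h1 : (∏ j, c j (a₁ j)) + ∏ j, d j (β₁ j) = 0)
    (h2 : (∏ j, c j (a₂ j)) + ∏ j, d j (β₂ j) = 0)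
    (h12 : (∏ j, c j (a₁₂ j)) + ∏ j, d j (β₁₂ j) = 0)
    (halive : (∏ j, c j (a₁₂ j)) ≠ 0) :
    ∃ β₀ : Fin m → E, (∀ j, β₀ j ∈ B j) ∧
      (∀ j, (β₀ j = β₁ j ∧ β₂ j = β₁₂ j) ∨ (β₀ j = β₂ j ∧ β₁ j = β₁₂ j)) ∧
      (∏ j, c j (a j)) + ∏ j, d j (β₀ j) = 0 := by
  obtain ⟨β₀, hβ₀, hrect⟩ := exists_merge_word B β₁ β₂ β₁₂ hβ₁ hβ₂ hcf
  refine ⟨β₀, hβ₀, hrect, ?_⟩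
  have eB := prod_rect_eq d β₀ β₁ β₂ β₁₂ hrect
  have eA := prod_rect_eq c a a₁ a₂ a₁₂ hArect
  have e1 : ∏ j, d j (β₁ j) = -∏ j, c j (a₁ j) := by linear_combination h1
  have e2 : ∏ j, d j (β₂ j) = -∏ j, c j (a₂ j) := by linear_combination h2
  have e12 : ∏ j, d j (β₁₂ j) = -∏ j, c j (a₁₂ j) := by linear_combination h12
  have hd12 : (∏ j, d j (β₁₂ j)) ≠ 0 := by rw [e12]; exact neg_ne_zero.mpr halive
  have key : (∏ j, d j (β₁₂ j)) * ((∏ j, c j (a j)) + ∏ j, d j (β₀ j)) = 0 := by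
    linear_combination eB - eA + (∏ j, d j (β₂ j)) * e1 - (∏ j, c j (a₁ j)) * e2
      + (∏ j, c j (a j)) * e12
  rcases mul_eq_zero.mp key with h | h
  · exact absurd h hd12
  · exact h

/-! ## §3  Polynomial form on two dissociated frames -/

/-- The floor's coefficient formula for ONE product on a dissociated frame: `coeff (Σ_j a_j) (Π_j f_j) = Π_j coeff (a_j) f_j`.
(`DissociatedFixedK.coeff_sum_prod_of_dissociated` at `k = 1`.) [folklore] -/
theorem coeff_prod_of_dissociated {m : ℕ} (A : Fin m → Finset (Fin 2 →₀ ℕ))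
    (f : Fin m → MvPolynomial (Fin 2) ℂ) (hf : ∀ j, (f j).support ⊆ A j)
    (hinj : ∀ a b : Fin m → (Fin 2 →₀ ℕ), (∀ j, a j ∈ A j) → (∀ j, b j ∈ A j) →
      ∑ j, a j = ∑ j, b j → a = b)
    (a : Fin m → (Fin 2 →₀ ℕ)) (ha : ∀ j, a j ∈ A j) :
    coeff (∑ j, a j) (∏ j, f j) = ∏ j, coeff (a j) (f j) := by
  have h := Summit.ValiantsHypothesis.Theorems.DissociatedFixedK.coeff_sum_prod_of_dissociated A
    (fun _ : Fin 1 => f) (fun _ j => hf j) hinj a ha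
  simpa using h

/-- **Carry lemma, polynomial form** (two products on two dissociated frames, `F = Π_j f_j + Π_j g_j`, `supp f_j ⊆ A_j`,
`supp g_j ⊆ B_j`).  If `(a, a₁, a₂, a₁₂)` is a rectangle of `A`-words, `β₁, β₂, β₁₂` are `B`-words with the same exponent
sums as `a₁, a₂, a₁₂`, the three exponents `Σ a₁, Σ a₂, Σ a₁₂` are NOT in the support of `F` (cancelled), `Π f` is alive at
`a₁₂`, and the `B`-words are carry-free, then `Σ_j a_j` lies in the `B`-sumset (it is the exponent sum of a `B`-word) and
is NOT in the support of `F` either.  Contrapositive (the form used at a cross-cancelling vertex `e = Σ a` of `Newt F`): every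
cancelled 2-face of the demotion cube through the vertex word CARRIES in the other frame. [folklore] -/
theorem coeff_eq_zero_of_carryFree_face {m : ℕ} (A B : Fin m → Finset (Fin 2 →₀ ℕ))
    (f g : Fin m → MvPolynomial (Fin 2) ℂ)
    (hf : ∀ j, (f j).support ⊆ A j) (hg : ∀ j, (g j).support ⊆ B j)
    (hA : ∀ a b : Fin m → (Fin 2 →₀ ℕ), (∀ j, a j ∈ A j) → (∀ j, b j ∈ A j) → ∑ j, a j = ∑ j, b j → a = b)
    (hB : ∀ a b : Fin m → (Fin 2 →₀ ℕ), (∀ j, a j ∈ B j) → (∀ j, b j ∈ B j) → ∑ j, a j = ∑ j, b j → a = b)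
    (a a₁ a₂ a₁₂ : Fin m → (Fin 2 →₀ ℕ))
    (ha : ∀ j, a j ∈ A j) (ha₁ : ∀ j, a₁ j ∈ A j) (ha₂ : ∀ j, a₂ j ∈ A j) (ha₁₂ : ∀ j, a₁₂ j ∈ A j)
    (hArect : ∀ j, (a j = a₁ j ∧ a₂ j = a₁₂ j) ∨ (a j = a₂ j ∧ a₁ j = a₁₂ j))
    (β₁ β₂ β₁₂ : Fin m → (Fin 2 →₀ ℕ))
    (hβ₁ : ∀ j, β₁ j ∈ B j) (hβ₂ : ∀ j, β₂ j ∈ B j) (hβ₁₂ : ∀ j, β₁₂ j ∈ B j)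
    (hs₁ : ∑ j, β₁ j = ∑ j, a₁ j) (hs₂ : ∑ j, β₂ j = ∑ j, a₂ j) (hs₁₂ : ∑ j, β₁₂ j = ∑ j, a₁₂ j)
    (hc₁ : (∑ j, a₁ j) ∉ ((∏ j, f j) + ∏ j, g j).support)
    (hc₂ : (∑ j, a₂ j) ∉ ((∏ j, f j) + ∏ j, g j).support)
    (hc₁₂ : (∑ j, a₁₂ j) ∉ ((∏ j, f j) + ∏ j, g j).support)
    (halive : ∀ j, coeff (a₁₂ j) (f j) ≠ 0)
    (hcf : ∀ j, β₁ j = β₁₂ j ∨ β₂ j = β₁₂ j) :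
    ∃ β₀ : Fin m → (Fin 2 →₀ ℕ), (∀ j, β₀ j ∈ B j) ∧ ∑ j, β₀ j = ∑ j, a j ∧
      (∑ j, a j) ∉ ((∏ j, f j) + ∏ j, g j).support := by
  classical
  -- coefficient tensors
  set c : Fin m → (Fin 2 →₀ ℕ) → ℂ := fun j e => coeff e (f j) with hc
  set d : Fin m → (Fin 2 →₀ ℕ) → ℂ := fun j e => coeff e (g j) with hd
  -- the three cancellations in tensor form
  have cancel : ∀ (a' β' : Fin m → (Fin 2 →₀ ℕ)), (∀ j, a' j ∈ A j) → (∀ j, β' j ∈ B j) →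
      ∑ j, β' j = ∑ j, a' j → (∑ j, a' j) ∉ ((∏ j, f j) + ∏ j, g j).support →
      (∏ j, c j (a' j)) + ∏ j, d j (β' j) = 0 := by
    intro a' β' ha' hβ' hs hns
    have h0 : coeff (∑ j, a' j) ((∏ j, f j) + ∏ j, g j) = 0 := notMem_support_iff.mp hns
    rw [coeff_add, coeff_prod_of_dissociated A f hf hA a' ha', ← hs,
      coeff_prod_of_dissociated B g hg hB β' hβ'] at h0
    exact h0
  have h1 := cancel a₁ β₁ ha₁ hβ₁ hs₁ hc₁
  have h2 := cancel a₂ β₂ ha₂ hβ₂ hs₂ hc₂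
  have h12 := cancel a₁₂ β₁₂ ha₁₂ hβ₁₂ hs₁₂ hc₁₂
  have halive' : (∏ j, c j (a₁₂ j)) ≠ 0 := Finset.prod_ne_zero_iff.mpr fun j _ => halive j
  obtain ⟨β₀, hβ₀, hrect, hsum⟩ :=
    exists_merge_cancel B c d a a₁ a₂ a₁₂ β₁ β₂ β₁₂ hArect hβ₁ hβ₂ hcf h1 h2 h12 halive'
  -- exponent sums: `Σ β₀ + Σ β₁₂ = Σ β₁ + Σ β₂ = Σ a₁ + Σ a₂ = Σ a + Σ a₁₂`
  have eB : ∑ j, β₀ j + ∑ j, β₁₂ j = ∑ j, β₁ j + ∑ j, β₂ j :=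
    sum_rect_eq (fun _ (e : Fin 2 →₀ ℕ) => e) β₀ β₁ β₂ β₁₂ hrect
  have eA : ∑ j, a j + ∑ j, a₁₂ j = ∑ j, a₁ j + ∑ j, a₂ j :=
    sum_rect_eq (fun _ (e : Fin 2 →₀ ℕ) => e) a a₁ a₂ a₁₂ hArect
  have hβ₀sum : ∑ j, β₀ j = ∑ j, a j := by
    have : ∑ j, β₀ j + ∑ j, a₁₂ j = ∑ j, a j + ∑ j, a₁₂ j := by
      rw [← hs₁₂, eB, hs₁, hs₂, hs₁₂]
      exact eA.symm
    exact add_right_cancel this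
  refine ⟨β₀, hβ₀, hβ₀sum, ?_⟩
  rw [notMem_support_iff, coeff_add, coeff_prod_of_dissociated A f hf hA a ha, ← hβ₀sum,
    coeff_prod_of_dissociated B g hg hB β₀ hβ₀]
  exact hsum

end Summit.ValiantsHypothesis.ValiantsHypothesis.Theorems.NewtonFramesTwoProducts.FrameRungTwoCarry
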